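import Mathlib

/-!
# Crux `GradientComparability` (stmt-CriticalPhenomena-10269), line `Sketch` — stub
# `stub_levelCurve_IFT`: the 2-D implicit function theorem for level curves

Route `CardySelfRefinement`, sub-problem `CriticalPhenomena/CardyFormulaZ2`.  Pure analysis
(ANALYSIS ENGINE 2 of the line's skeleton `Cruxes/GradientComparability/Lines/Sketch.lean`): the
bulk chart transports Kesten's near-critical window along the critical curve as the vertical gap
between two LEVEL CURVES of the crossing polynomial `Φ_η = P_η` (`exists_contDiff_eq_P`); this
file supplies their existence, uniqueness and the level-curve ODE.

Let `Φ : ℝ² → ℝ` be `C¹`; on `ρ ∈ [a,b]` assume `Φ(ρ,0) < v < Φ(ρ,1)`, `Φ(ρ,·)` monotone on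
`[0,1]`, and `∂cΦ > 0` wherever `Φ(ρ,·) = v` on `[0,1]`.  Then there is a level function `cv`
with `Φ(ρ, cv ρ) = v`, `cv ρ ∈ (0,1)`, unique among level points in `[0,1]`, solving
`cv' = −∂ρΦ/∂cΦ` within `[a,b]` (one-sided at the ends).  Proof: intermediate value theorem
(existence); monotonicity + `∂cΦ > 0` (uniqueness: on a level interval the `c`-derivative would
vanish); inverse function theorem (`HasStrictFDerivAt.to_localInverse`) for
`F(x,y) = (x, Φ(x,y))`, whose strict derivative `(h₁,h₂) ↦ (h₁, ∂ρΦ h₁ + ∂cΦ h₂)` is invertible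
when `∂cΦ ≠ 0`; the second component of the local inverse along `y = v` is a local level
function with derivative `−∂ρΦ/∂cΦ`, equal to `cv` near the point by uniqueness.
(Dieudonné, *Foundations of Modern Analysis*, (10.2.1); folklore.)
-/

noncomputable section

namespace Summit.CriticalPhenomena.CardyFormulaZ2.Theorems.CardySelfRefinement

open scoped Topology
open Filter Set

/-- A continuous linear functional on `ℝ × ℝ` in coordinates. -/
theorem clm_apply_prod (L : (ℝ × ℝ) →L[ℝ] ℝ) (h : ℝ × ℝ) :
    L h = h.1 * L (1, 0) + h.2 * L (0, 1) := by
  have : h = h.1 • ((1 : ℝ), (0 : ℝ)) + h.2 • ((0 : ℝ), (1 : ℝ)) := by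
    ext <;> simp
  conv_lhs => rw [this]
  simp only [map_add, map_smul, smul_eq_mul]

/-- The derivative of `t ↦ Φ(ρ, c + t)` at `0` is `∂cΦ(ρ, c)`. -/
theorem hasDerivAt_slice_snd {Φ : ℝ × ℝ → ℝ} (hΦ : Differentiable ℝ Φ) (ρ c : ℝ) :
    HasDerivAt (fun t : ℝ => Φ (ρ, c + t)) (fderiv ℝ Φ (ρ, c) (0, 1)) 0 := by
  have hcurve : HasDerivAt (fun t : ℝ => ((ρ, c + t) : ℝ × ℝ)) ((0 : ℝ), (1 : ℝ)) 0 := by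
    refine HasDerivAt.prodMk (hasDerivAt_const _ _) ?_
    simpa using (hasDerivAt_id (0 : ℝ)).const_add c
  have h := ((hΦ (ρ, c + 0)).hasFDerivAt.comp (0 : ℝ) hcurve.hasFDerivAt).hasDerivAt
  simp only [add_zero, ContinuousLinearMap.coe_comp, Function.comp_apply,
    ContinuousLinearMap.toSpanSingleton_apply, one_smul] at h
  exact h

/-- The derivative of the horizontal line `x ↦ (x, v)` is `(1, 0)`. -/
theorem hasDerivAt_horizontal (v ρ : ℝ) :
    HasDerivAt (fun x : ℝ => ((x, v) : ℝ × ℝ)) ((1 : ℝ), (0 : ℝ)) ρ :=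
  HasDerivAt.prodMk (hasDerivAt_id ρ) (hasDerivAt_const _ _)

/-- **Uniqueness of the level point.**  If `c ↦ Φ(ρ,c)` is monotone on `[0,1]`, `Φ` is
differentiable, and the `c`-derivative is positive wherever `Φ(ρ,·) = v` on `[0,1]`, then
`Φ(ρ,·)` takes the value `v` at most once on `[0,1]`. -/
theorem levelPoint_unique {Φ : ℝ × ℝ → ℝ} (hΦ : Differentiable ℝ Φ) {ρ v : ℝ}
    (hmono : MonotoneOn (fun c => Φ (ρ, c)) (Icc 0 1))
    (hpos : ∀ c ∈ Icc (0 : ℝ) 1, Φ (ρ, c) = v → 0 < fderiv ℝ Φ (ρ, c) (0, 1))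
    {c₁ c₂ : ℝ} (hc₁ : c₁ ∈ Icc (0 : ℝ) 1) (hc₂ : c₂ ∈ Icc (0 : ℝ) 1)
    (h₁ : Φ (ρ, c₁) = v) (h₂ : Φ (ρ, c₂) = v) : c₁ = c₂ := by
  by_contra hne
  wlog hlt : c₁ < c₂ generalizing c₁ c₂
  · exact this hc₂ hc₁ h₂ h₁ (Ne.symm hne) (lt_of_le_of_ne (not_lt.1 hlt) (Ne.symm hne))
  -- `Φ(ρ,·) = v` on `[c₁, c₂]`
  have hconst : ∀ c ∈ Icc c₁ c₂, Φ (ρ, c) = v := by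
    intro c hc
    have hc01 : c ∈ Icc (0 : ℝ) 1 := ⟨hc₁.1.trans hc.1, hc.2.trans hc₂.2⟩
    apply le_antisymm
    · rw [← h₂]; exact hmono hc01 hc₂ hc.2
    · rw [← h₁]; exact hmono hc₁ hc01 hc.1
  -- the derivative of `t ↦ Φ(ρ, c₁ + t)` at `0` within `[0, c₂ - c₁]` is both `D > 0` and `0`
  set D := fderiv ℝ Φ (ρ, c₁) (0, 1) with hD
  have hDpos : 0 < D := hpos c₁ hc₁ h₁
  have hI : UniqueDiffWithinAt ℝ (Icc 0 (c₂ - c₁)) 0 :=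
    uniqueDiffOn_Icc (by linarith) 0 (left_mem_Icc.2 (by linarith))
  have hD' : HasDerivWithinAt (fun t : ℝ => Φ (ρ, c₁ + t)) D (Icc 0 (c₂ - c₁)) 0 :=
    (hasDerivAt_slice_snd hΦ ρ c₁).hasDerivWithinAt
  have h0' : HasDerivWithinAt (fun t : ℝ => Φ (ρ, c₁ + t)) 0 (Icc 0 (c₂ - c₁)) 0 := by
    refine (hasDerivWithinAt_const (0 : ℝ) (Icc 0 (c₂ - c₁)) v).congr_of_mem (fun t ht => ?_)
      (left_mem_Icc.2 (by linarith))
    exact hconst _ ⟨by linarith [ht.1], by linarith [ht.2]⟩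
  have : D = 0 := hI.eq_deriv _ hD' h0'
  linarith

/-- **2-D implicit function theorem for a level curve, with one-sided derivatives at the ends**
(registered stub `stub_levelCurve_IFT` of line `Sketch`).
Let `Φ : ℝ² → ℝ` be `C¹`; on `ρ ∈ [a,b]` assume `Φ(ρ,0) < v < Φ(ρ,1)`, `Φ(ρ,·)` monotone on
`[0,1]`, and `∂cΦ > 0` at the level `v`.  Then there is a level function `cv` with
`Φ(ρ, cv ρ) = v`, `cv ρ ∈ (0,1)`, unique among level points in `[0,1]`, and solving the level-curve
ODE `cv' = −∂ρΦ/∂cΦ` within `[a,b]`. -/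
theorem stub_levelCurve_IFT (Φ : ℝ × ℝ → ℝ) (hΦ : ContDiff ℝ 1 Φ) (a b v : ℝ)
    (hbv : ∀ ρ ∈ Set.Icc a b, Φ (ρ, 0) < v ∧ v < Φ (ρ, 1))
    (hmono : ∀ ρ ∈ Set.Icc a b, MonotoneOn (fun c => Φ (ρ, c)) (Set.Icc 0 1))
    (hpos : ∀ ρ ∈ Set.Icc a b, ∀ c ∈ Set.Icc (0 : ℝ) 1, Φ (ρ, c) = v → 0 < fderiv ℝ Φ (ρ, c) (0, 1)) :
    ∃ cv : ℝ → ℝ, (∀ ρ ∈ Set.Icc a b, cv ρ ∈ Set.Ioo (0 : ℝ) 1 ∧ Φ (ρ, cv ρ) = v ∧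
        ∀ c ∈ Set.Icc (0 : ℝ) 1, Φ (ρ, c) = v → c = cv ρ) ∧
      ∀ ρ ∈ Set.Icc a b, HasDerivWithinAt cv
        (-(fderiv ℝ Φ (ρ, cv ρ) (1, 0) / fderiv ℝ Φ (ρ, cv ρ) (0, 1))) (Set.Icc a b) ρ := by
  have hdiff : Differentiable ℝ Φ := hΦ.differentiable (by norm_num)
  have hcont : Continuous Φ := hΦ.continuous
  -- existence of a level point for each `ρ ∈ [a,b]` (intermediate value theorem)
  have hex : ∀ ρ ∈ Icc a b, ∃ c ∈ Icc (0 : ℝ) 1, Φ (ρ, c) = v := by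
    intro ρ hρ
    have hc : ContinuousOn (fun c : ℝ => Φ (ρ, c)) (Icc 0 1) :=
      (hcont.comp (continuous_const.prodMk continuous_id)).continuousOn
    have hmem : v ∈ Icc (Φ (ρ, 0)) (Φ (ρ, 1)) := ⟨(hbv ρ hρ).1.le, (hbv ρ hρ).2.le⟩
    obtain ⟨c, hc01, hcv⟩ := intermediate_value_Icc zero_le_one hc hmem
    exact ⟨c, hc01, hcv⟩
  classical
  let cv : ℝ → ℝ := fun ρ => if hρ : ρ ∈ Icc a b then Classical.choose (hex ρ hρ) else 0
  have hcv_spec : ∀ ρ (hρ : ρ ∈ Icc a b), cv ρ ∈ Icc (0 : ℝ) 1 ∧ Φ (ρ, cv ρ) = v := by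
    intro ρ hρ
    simp only [cv, hρ, dif_pos]
    exact Classical.choose_spec (hex ρ hρ)
  have huniq : ∀ ρ ∈ Icc a b, ∀ c ∈ Icc (0 : ℝ) 1, Φ (ρ, c) = v → c = cv ρ := by
    intro ρ hρ c hc hcv'
    exact levelPoint_unique hdiff (hmono ρ hρ) (hpos ρ hρ) hc (hcv_spec ρ hρ).1 hcv' (hcv_spec ρ hρ).2
  have hIoo : ∀ ρ ∈ Icc a b, cv ρ ∈ Ioo (0 : ℝ) 1 := by
    intro ρ hρ
    obtain ⟨h01, hv⟩ := hcv_spec ρ hρ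
    refine ⟨lt_of_le_of_ne h01.1 ?_, lt_of_le_of_ne h01.2 ?_⟩
    · intro h0; rw [← h0] at hv; linarith [(hbv ρ hρ).1]
    · intro h1; rw [h1] at hv; linarith [(hbv ρ hρ).2]
  refine ⟨cv, fun ρ hρ => ⟨hIoo ρ hρ, (hcv_spec ρ hρ).2, huniq ρ hρ⟩, fun ρ hρ => ?_⟩
  -- the local inverse of `F(x,y) = (x, Φ(x,y))` at `q₀ = (ρ, cv ρ)`
  set q₀ : ℝ × ℝ := (ρ, cv ρ) with hq₀
  set D₁ : ℝ := fderiv ℝ Φ q₀ (1, 0) with hD₁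
  set D₂ : ℝ := fderiv ℝ Φ q₀ (0, 1) with hD₂
  have hD₂pos : 0 < D₂ := hpos ρ hρ (cv ρ) (hcv_spec ρ hρ).1 (hcv_spec ρ hρ).2
  have hD₂ne : D₂ ≠ 0 := hD₂pos.ne'
  let F : ℝ × ℝ → ℝ × ℝ := fun p => (p.1, Φ p)
  let A : (ℝ × ℝ) →L[ℝ] (ℝ × ℝ) := (ContinuousLinearMap.fst ℝ ℝ ℝ).prod (fderiv ℝ Φ q₀)
  let B : (ℝ × ℝ) →L[ℝ] (ℝ × ℝ) :=
    (ContinuousLinearMap.fst ℝ ℝ ℝ).prod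
      (D₂⁻¹ • (ContinuousLinearMap.snd ℝ ℝ ℝ - D₁ • ContinuousLinearMap.fst ℝ ℝ ℝ))
  have hA : ∀ h : ℝ × ℝ, A h = (h.1, h.1 * D₁ + h.2 * D₂) := by
    intro h
    simp only [A, ContinuousLinearMap.prod_apply, ContinuousLinearMap.coe_fst']
    rw [clm_apply_prod (fderiv ℝ Φ q₀) h]
  have hB : ∀ k : ℝ × ℝ, B k = (k.1, D₂⁻¹ * (k.2 - D₁ * k.1)) := fun k => rfl
  have hBA : ∀ h, B (A h) = h := by
    intro h; rw [hA, hB]; ext <;> simp; field_simp; ring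
  have hAB : ∀ k, A (B k) = k := by
    intro k; rw [hB, hA]; ext <;> simp; field_simp; ring
  let e : (ℝ × ℝ) ≃L[ℝ] (ℝ × ℝ) := ContinuousLinearEquiv.equivOfInverse A B hBA hAB
  have he : (e : (ℝ × ℝ) →L[ℝ] (ℝ × ℝ)) = A := rfl
  have hesymm : ∀ k, e.symm k = B k := fun k => rfl
  have hFderiv : HasStrictFDerivAt F (e : (ℝ × ℝ) →L[ℝ] (ℝ × ℝ)) q₀ := by
    have h1 : HasStrictFDerivAt (fun p : ℝ × ℝ => p.1) (ContinuousLinearMap.fst ℝ ℝ ℝ) q₀ :=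
      hasStrictFDerivAt_fst
    have h2 : HasStrictFDerivAt Φ (fderiv ℝ Φ q₀) q₀ := hΦ.contDiffAt.hasStrictFDerivAt one_ne_zero
    rw [he]
    exact h1.prodMk h2
  -- `g ρ' := (ψ (ρ', v)).2` solves the level equation near `ρ` with the right derivative
  set ψ := hFderiv.localInverse F e q₀ with hψ
  have hFq₀ : F q₀ = (ρ, v) := by
    simp only [F, hq₀, (hcv_spec ρ hρ).2]
  have hright : ∀ᶠ y in 𝓝 (F q₀), F (ψ y) = y := hFderiv.eventually_right_inverse
  have hψcont : ContinuousAt ψ (F q₀) := hFderiv.localInverse_continuousAt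
  have hψderiv : HasStrictFDerivAt ψ (e.symm : (ℝ × ℝ) →L[ℝ] (ℝ × ℝ)) (F q₀) :=
    hFderiv.to_localInverse
  have hψq₀ : ψ (F q₀) = q₀ := hFderiv.localInverse_apply_image
  rw [hFq₀] at hright hψcont hψderiv hψq₀
  let g : ℝ → ℝ := fun ρ' => (ψ (ρ', v)).2
  -- derivative of `g` at `ρ`
  have hg : HasDerivAt g (-(D₁ / D₂)) ρ := by
    have h := (hψderiv.hasFDerivAt.comp ρ (hasDerivAt_horizontal v ρ).hasFDerivAt).snd.hasDerivAt
    simp only [ContinuousLinearMap.coe_comp, Function.comp_apply,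
      ContinuousLinearMap.toSpanSingleton_apply, one_smul,
      ContinuousLinearMap.coe_snd', ContinuousLinearEquiv.coe_coe] at h
    rw [hesymm, hB] at h
    refine h.congr_deriv ?_
    simp only
    field_simp
    ring
  -- `g = cv` on `[a,b]` near `ρ`
  have hlev : ∀ᶠ ρ' in 𝓝 ρ, (ψ (ρ', v)).1 = ρ' ∧ Φ (ψ (ρ', v)) = v := by
    have ht : Tendsto (fun ρ' : ℝ => ((ρ', v) : ℝ × ℝ)) (𝓝 ρ) (𝓝 (ρ, v)) :=
      ((continuous_id.prodMk continuous_const).tendsto ρ)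
    filter_upwards [ht.eventually hright] with ρ' h'
    have h1 := congrArg Prod.fst h'
    have h2 := congrArg Prod.snd h'
    simp only [F] at h1 h2
    exact ⟨h1, h2⟩
  have hnear : ∀ᶠ ρ' in 𝓝 ρ, g ρ' ∈ Ioo (0 : ℝ) 1 := by
    have hgc : ContinuousAt g ρ := by
      have : ContinuousAt (fun ρ' : ℝ => ψ (ρ', v)) ρ :=
        hψcont.comp_of_eq ((continuous_id.prodMk continuous_const).continuousAt) rfl
      exact (continuous_snd.continuousAt).comp this
    have hg0 : g ρ = cv ρ := by
      show (ψ (ρ, v)).2 = cv ρ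
      rw [hψq₀]
    have : g ρ ∈ Ioo (0 : ℝ) 1 := hg0 ▸ hIoo ρ hρ
    exact hgc.eventually (isOpen_Ioo.mem_nhds this)
  have hEq : cv =ᶠ[𝓝[Icc a b] ρ] g := by
    rw [eventuallyEq_nhdsWithin_iff]
    filter_upwards [hlev, hnear] with ρ' h1 h2 hρ'
    have hψeq : ψ (ρ', v) = (ρ', g ρ') := Prod.ext h1.1 rfl
    have hΦg : Φ (ρ', g ρ') = v := by rw [← hψeq]; exact h1.2
    exact (huniq ρ' hρ' (g ρ') ⟨h2.1.le, h2.2.le⟩ hΦg).symm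
  have hg0 : cv ρ = g ρ := by
    show cv ρ = (ψ (ρ, v)).2
    rw [hψq₀]
  exact hg.hasDerivWithinAt.congr_of_eventuallyEq hEq hg0

end Summit.CriticalPhenomena.CardyFormulaZ2.Theorems.CardySelfRefinement

end
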